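import Literature.Computability.QuantumComplexity.ForrelationThm25Instance
import HarnessLib

/-!
# Embedding circuits on blocks of wires; product states over disjoint blocks

Infrastructure for circuits built from independent sub-circuits acting on pairwise disjoint
blocks of wires (trunk `CryptoQuantFine` model of `QuantumCircuit.lean`), as in the uniform
`BQP^O` machine of Raz–Tal (J. ACM 69 (2022), App. A with Claim 8.1: `m` independent runs of the
one-query Forrelation algorithm on fresh qubits, followed by a classical threshold) and, more
generally, in every amplification-by-repetition argument (Nielsen–Chuang 2010, §4.5.2;
Bernstein–Vazirani 1997, §8):

* transport of circuits along a wire embedding `E : Fin b ↪ Fin W` is the tree's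
  `mapWiresGate`/`mapWires` with `toMatrix_mapWires : (mapWires E C).toMatrix A =
  placeGate E (C.toMatrix A)` (`ForrelationThm25Instance.lean`); here: `size_mapWires`,
  `mapWires_append`, oracle-freeness and wires of transported gates;
* `placeGate_mulVec_apply` — the action of a placed operator on a state vector, entrywise
  (companion of `placeGate_mul_apply` of `ForrelationThm25Amplitude.lean`);
* `prodState E φ c` — for blocks `E i : Fin b ↪ Fin W` (`i < m`), block states
  `φ i : QReg b → ℂ` and a classical content `c` of the remaining wires, the product state
  `|c|_{off}⟩ ⊗ ⨂ᵢ φᵢ` written as a function on `QReg W`;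
  `basisState_eq_prodState` (a basis state is the product of its block restrictions);
* **frame rule** `placeGate_mulVec_prodState` / `toMatrix_mapWires_mulVec_prodState`: for pairwise
  disjoint blocks, an operator placed on block `j` acts on the `j`-th factor only
  (`(1 ⊗ U ⊗ 1)(⨂ φᵢ) = φ₁ ⊗ ⋯ ⊗ Uφⱼ ⊗ ⋯`, Nielsen–Chuang §2.1.7, Eq. (2.45));
* `blockGlue`, `blockEquiv` — `QReg W ≃ (off-block wires → Bool) × (Fin m → QReg b)`, whence
  **`sum_prodIndicator`**: summing a function of the block contents over the registers with
  prescribed off-block content is summing over all tuples of block contents, and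
  **`sum_normSq_prodState_mul`**: `∑_z |prodState z|² g(blocks of z) = ∑_y (∏ᵢ |φᵢ(yᵢ)|²) g(y)`
  — the Born weights of a product state form the product distribution (Nielsen–Chuang §2.2.8);
* `mulVec_eq_of_perm`, `sum_ite_normSq_mulVec_of_perm` — a circuit permuting basis states
  (`M|z⟩ = |π z⟩` for a self-embedding `π : QReg W ↪ QReg W`, a bijection by Mathlib's
  `Function.Embedding.equivOfFiniteSelfEmbedding`; e.g. a compiled reversible classical circuit,
  `revCompile_mulVec_basisState`) permutes the Born weights: `∑_{y ∈ T} |(Mψ)(y)|² =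
  ∑_{π z ∈ T} |ψ(z)|²` (classical post-processing before the measurement).

## References

* M. A. Nielsen, I. L. Chuang, *Quantum Computation and Quantum Information*, CUP 2010,
  §2.1.7 (tensor products, Eq. (2.45)), §2.2.8 (composite systems), §4.3 (a gate on a subset of
  the wires acts as `U ⊗ 1`), §4.5.2.
* R. Raz, A. Tal, *Oracle separation of BQP and PH*, J. ACM 69 (2022), App. A, Claim 8.1
  [RazTalJACM2022].
* E. Bernstein, U. Vazirani, *Quantum complexity theory*, SIAM J. Comput. 26 (1997), §8.
-/

noncomputable section

open Matrix

namespace Literature.Computability.QuantumComplexity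

open Cryptography

variable {G : QGateSet} {b W : ℕ}

/-! ### Transport along a wire embedding: sizes, concatenation, oracle-freeness, wires -/

/-- The gates of a transported circuit. [folklore] -/
@[simp] theorem gates_mapWires (E : Fin b ↪ Fin W) (C : QCircuit G b) :
    (mapWires E C).gates = C.gates.map (mapWiresGate E) := rfl

/-- Transport preserves the size. [folklore] -/
@[simp] theorem size_mapWires (E : Fin b ↪ Fin W) (C : QCircuit G b) : (mapWires E C).size = C.size := by
  simp [mapWires, QCircuit.size]

/-- Transport of a concatenation. [folklore] -/
theorem mapWires_append (E : Fin b ↪ Fin W) (C D : QCircuit G b) :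
    mapWires E (C.append D) = (mapWires E C).append (mapWires E D) := by
  simp [mapWires, QCircuit.append]

/-- Transport preserves oracle-freeness of gates. [folklore] -/
theorem isOracleFree_mapWiresGate (E : Fin b ↪ Fin W) {g : QGate G b} (hg : g.IsOracleFree) :
    (mapWiresGate E g).IsOracleFree := by
  cases g with
  | gate _ _ => trivial
  | oracle _ _ => exact absurd hg id

/-- Transport preserves oracle-freeness of circuits. [folklore] -/
theorem isOracleFree_mapWires (E : Fin b ↪ Fin W) {C : QCircuit G b} (hC : C.IsOracleFree) :
    (mapWires E C).IsOracleFree := by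
  intro g hg
  rw [gates_mapWires] at hg
  obtain ⟨g', hg', rfl⟩ := List.mem_map.1 hg
  exact isOracleFree_mapWiresGate E (hC g' hg')

/-- The wires of a transported gate lie in the block. [folklore] -/
theorem wires_mapWiresGate_subset (E : Fin b ↪ Fin W) (g : QGate G b) :
    ∀ w ∈ (mapWiresGate E g).wires, w ∈ Set.range E := by
  intro w hw
  cases g with
  | gate g e =>
    simp only [mapWiresGate, QGate.wires, Finset.mem_map, Finset.mem_univ, true_and] at hw
    obtain ⟨i, rfl⟩ := hw
    exact ⟨e i, rfl⟩
  | oracle k e =>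
    simp only [mapWiresGate, QGate.wires, Finset.mem_map, Finset.mem_univ, true_and] at hw
    obtain ⟨i, rfl⟩ := hw
    exact ⟨e i, rfl⟩

/-! ### Placed operators on state vectors -/

/-- **A placed operator on a state vector, entrywise**:
`(U_E ψ)(x) = ∑_{z ∈ {0,1}^b} U(x|_E, z) ψ(x with E ↦ z)`. [Nielsen–Chuang 2010, §4.3]
[cite: NielsenChuang2010, §4.3] -/
theorem placeGate_mulVec_apply (E : Fin b ↪ Fin W) (U : Matrix (QReg b) (QReg b) ℂ)
    (ψ : QReg W → ℂ) (x : QReg W) :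
    (placeGate E U *ᵥ ψ) x = ∑ z : QReg b, U (x ∘ E) z * ψ (Function.extend E z x) := by
  rw [Matrix.mulVec, dotProduct]
  have h : ∀ w, placeGate E U x w * ψ w =
      if (∀ i, i ∉ Set.range E → w i = x i) then U (x ∘ E) (w ∘ E) * ψ w else 0 := by
    intro w
    rw [placeGate_apply]
    by_cases hw : ∀ i, i ∉ Set.range E → x i = w i
    · rw [if_pos hw, if_pos fun i hi => (hw i hi).symm]
    · rw [if_neg hw, if_neg fun h' => hw fun i hi => (h' i hi).symm, zero_mul]
  simp_rw [h]
  rw [sum_ite_agree_eq_sum_extend]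
  simp_rw [extend_comp_embedding]

open Finset

open scoped Classical

variable {m : ℕ}

/-! ### Product states over disjoint blocks -/

/-- The blocks `E i` are pairwise disjoint. [folklore] -/
def BlockDisjoint (E : Fin m → (Fin b ↪ Fin W)) : Prop :=
  ∀ i j, i ≠ j → Disjoint (Set.range (E i)) (Set.range (E j))

/-- The wire `w` lies in no block. [folklore] -/
def OffBlocks (E : Fin m → (Fin b ↪ Fin W)) (w : Fin W) : Prop := ∀ i, w ∉ Set.range (E i)

/-- **Product states.** Given blocks `E i : Fin b ↪ Fin W`, block states `φ i` and a classical
content `c` for the remaining wires, the state `|c|_{off}⟩ ⊗ ⨂ᵢ φᵢ` as a function on `QReg W`: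
the amplitude of `z` is `∏ᵢ φᵢ(z|_{Eᵢ})` if `z` agrees with `c` off the blocks, and `0` otherwise.
[Nielsen–Chuang 2010, §2.1.7 and §2.2.8] [cite: NielsenChuang2010, §2.2.8] -/
def prodState (E : Fin m → (Fin b ↪ Fin W)) (φ : Fin m → QReg b → ℂ) (c : QReg W) : QReg W → ℂ :=
  fun z => (if ∀ w, OffBlocks E w → z w = c w then 1 else 0) * ∏ i, φ i (z ∘ E i)

/-- The amplitudes of a product state (definitional). [folklore] -/
theorem prodState_apply (E : Fin m → (Fin b ↪ Fin W)) (φ : Fin m → QReg b → ℂ) (c z : QReg W) :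
    prodState E φ c z = (if ∀ w, OffBlocks E w → z w = c w then 1 else 0) * ∏ i, φ i (z ∘ E i) := rfl

/-- The product state only depends on the off-block part of the classical content. [folklore] -/
theorem prodState_congr_content (E : Fin m → (Fin b ↪ Fin W)) (φ : Fin m → QReg b → ℂ) {c c' : QReg W}
    (h : ∀ w, OffBlocks E w → c w = c' w) : prodState E φ c = prodState E φ c' := by
  funext z
  simp only [prodState_apply]
  congr 2
  exact propext ⟨fun hz w hw => (hz w hw).trans (h w hw), fun hz w hw => (hz w hw).trans (h w hw).symm⟩

/-- **A basis state is the product of its restrictions to the blocks.**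
[Nielsen–Chuang 2010, §2.1.7] [cite: NielsenChuang2010, §2.1.7] -/
theorem basisState_eq_prodState (E : Fin m → (Fin b ↪ Fin W)) (c : QReg W) :
    basisState c = prodState E (fun i => basisState (c ∘ E i)) c := by
  funext z
  rw [prodState_apply, basisState_apply]
  by_cases hz : z = c
  · rw [if_pos hz, if_pos (fun w _ => by rw [hz])]
    rw [eq_comm, one_mul]
    exact Finset.prod_eq_one fun i _ => by rw [hz, basisState_apply, if_pos rfl]
  · rw [if_neg hz]
    by_cases hoff : ∀ w, OffBlocks E w → z w = c w
    · -- `z ≠ c` but they agree off the blocks: some block differs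
      rw [if_pos hoff, one_mul, eq_comm]
      apply Finset.prod_eq_zero_iff.2
      by_contra hall
      push Not at hall
      apply hz
      funext w
      by_cases hw : OffBlocks E w
      · exact hoff w hw
      · simp only [OffBlocks, not_forall, not_not] at hw
        obtain ⟨i, p, rfl⟩ := hw
        have hi := hall i (Finset.mem_univ i)
        rw [basisState_apply] at hi
        by_cases heq : z ∘ E i = c ∘ E i
        · exact congrFun heq p
        · exact absurd (if_neg heq) hi
    · rw [if_neg hoff, zero_mul]

/-- Overwriting block `j` does not change the off-block wires. [folklore] -/
theorem extend_apply_of_offBlocks (E : Fin m → (Fin b ↪ Fin W)) (j : Fin m) (y : QReg b) (z : QReg W)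
    {w : Fin W} (hw : OffBlocks E w) : Function.extend (E j) y z w = z w :=
  extend_apply_of_not_mem (E j) y z (hw j)

/-- Overwriting block `j` does not change block `i ≠ j` (disjoint blocks). [folklore] -/
theorem extend_comp_of_ne {E : Fin m → (Fin b ↪ Fin W)} (hE : BlockDisjoint E) {i j : Fin m} (hij : i ≠ j)
    (y : QReg b) (z : QReg W) : Function.extend (E j) y z ∘ E i = z ∘ E i := by
  funext p
  exact extend_apply_of_not_mem (E j) y z fun hp => Set.disjoint_left.1 (hE i j hij) ⟨p, rfl⟩ hp

/-- **Frame rule.** For pairwise disjoint blocks, an operator placed on block `j` acts on the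
`j`-th factor of a product state and on nothing else:
`(1 ⊗ U_j ⊗ 1) (|c⟩ ⊗ ⨂ᵢ φᵢ) = |c⟩ ⊗ φ₀ ⊗ ⋯ ⊗ U φⱼ ⊗ ⋯`. [Nielsen–Chuang 2010, §2.1.7,
Eq. (2.45)] [cite: NielsenChuang2010, §2.1.7 eq. (2.45)] -/
theorem placeGate_mulVec_prodState {E : Fin m → (Fin b ↪ Fin W)} (hE : BlockDisjoint E) (j : Fin m)
    (U : Matrix (QReg b) (QReg b) ℂ) (φ : Fin m → QReg b → ℂ) (c : QReg W) :
    placeGate (E j) U *ᵥ prodState E φ c = prodState E (Function.update φ j (U *ᵥ φ j)) c := by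
  funext x
  rw [placeGate_mulVec_apply, prodState_apply]
  -- the factors other than `j`, and the off-block indicator, are the same in every summand
  have hsplit : ∀ (ψ : Fin m → QReg b → ℂ) (z : QReg W),
      ∏ i, ψ i (z ∘ E i) = ψ j (z ∘ E j) * ∏ i ∈ Finset.univ.erase j, ψ i (z ∘ E i) := fun ψ z =>
    (Finset.mul_prod_erase _ _ (Finset.mem_univ j)).symm
  have hterm : ∀ y : QReg b, U (x ∘ E j) y * prodState E φ c (Function.extend (E j) y x) =
      ((if ∀ w, OffBlocks E w → x w = c w then 1 else 0) * ∏ i ∈ Finset.univ.erase j, φ i (x ∘ E i)) *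
        (U (x ∘ E j) y * φ j y) := by
    intro y
    rw [prodState_apply, hsplit φ, extend_comp_embedding]
    have hoff : (∀ w, OffBlocks E w → Function.extend (E j) y x w = c w) ↔ ∀ w, OffBlocks E w → x w = c w := by
      refine ⟨fun h w hw => ?_, fun h w hw => ?_⟩
      · rw [← extend_apply_of_offBlocks E j y x hw]; exact h w hw
      · rw [extend_apply_of_offBlocks E j y x hw]; exact h w hw
    have hrest : ∏ i ∈ Finset.univ.erase j, φ i (Function.extend (E j) y x ∘ E i) =
        ∏ i ∈ Finset.univ.erase j, φ i (x ∘ E i) :=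
      Finset.prod_congr rfl fun i hi => by rw [extend_comp_of_ne hE (Finset.ne_of_mem_erase hi)]
    rw [hrest]
    by_cases hc : ∀ w, OffBlocks E w → x w = c w
    · rw [if_pos hc, if_pos (hoff.2 hc)]; ring
    · rw [if_neg hc, if_neg (mt hoff.1 hc)]; ring
  simp_rw [hterm]
  rw [← Finset.mul_sum, hsplit (Function.update φ j (U *ᵥ φ j)), Function.update_self]
  have hrest' : ∏ i ∈ Finset.univ.erase j, Function.update φ j (U *ᵥ φ j) i (x ∘ E i) =
      ∏ i ∈ Finset.univ.erase j, φ i (x ∘ E i) :=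
    Finset.prod_congr rfl fun i hi => by rw [Function.update_of_ne (Finset.ne_of_mem_erase hi)]
  rw [hrest', Matrix.mulVec, dotProduct]
  ring

/-- **Frame rule for embedded circuits**: a circuit embedded on block `j` transforms the `j`-th
factor of a product state by its own unitary. [Nielsen–Chuang 2010, §2.1.7, §4.3]
[cite: NielsenChuang2010, §2.1.7 eq. (2.45)] -/
theorem toMatrix_mapWires_mulVec_prodState {G : QGateSet} (A : Language Bool) {E : Fin m → (Fin b ↪ Fin W)}
    (hE : BlockDisjoint E) (j : Fin m) (C : QCircuit G b) (φ : Fin m → QReg b → ℂ) (c : QReg W) :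
    (mapWires (E j) C).toMatrix A *ᵥ prodState E φ c =
      prodState E (Function.update φ j (C.toMatrix A *ᵥ φ j)) c := by
  rw [toMatrix_mapWires, placeGate_mulVec_prodState hE]

/-- **Running independent circuits on all blocks**: embedding `C i` on block `i` for every `i`
(in the order of `Fin m`) maps the product state `⨂ φᵢ` to `⨂ (U_{Cᵢ} φᵢ)`.
[Nielsen–Chuang 2010, §2.1.7, §4.3] [cite: NielsenChuang2010, §2.1.7 eq. (2.45)] -/
theorem toMatrix_flatMap_mapWires_mulVec_prodState {G : QGateSet} (A : Language Bool)
    {E : Fin m → (Fin b ↪ Fin W)} (hE : BlockDisjoint E) (C : Fin m → QCircuit G b)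
    (φ : Fin m → QReg b → ℂ) (c : QReg W) :
    (⟨(List.finRange m).flatMap fun i => (mapWires (E i) (C i)).gates⟩ : QCircuit G W).toMatrix A *ᵥ
        prodState E φ c =
      prodState E (fun i => (C i).toMatrix A *ᵥ φ i) c := by
  -- more generally for any duplicate-free list of blocks
  suffices h : ∀ (l : List (Fin m)), l.Nodup → ∀ φ : Fin m → QReg b → ℂ,
      (⟨l.flatMap fun i => (mapWires (E i) (C i)).gates⟩ : QCircuit G W).toMatrix A *ᵥ prodState E φ c =
        prodState E (fun i => if i ∈ l then (C i).toMatrix A *ᵥ φ i else φ i) c by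
    have := h (List.finRange m) (List.nodup_finRange m) φ
    simpa using this
  intro l hl
  induction l with
  | nil => intro φ; simp
  | cons j l ih =>
    intro φ
    have hj : j ∉ l := (List.nodup_cons.1 hl).1
    rw [List.flatMap_cons, show (⟨(mapWires (E j) (C j)).gates ++ l.flatMap fun i => (mapWires (E i) (C i)).gates⟩ :
        QCircuit G W) = (mapWires (E j) (C j)).append ⟨l.flatMap fun i => (mapWires (E i) (C i)).gates⟩ from rfl,
      QCircuit.toMatrix_append, ← Matrix.mulVec_mulVec, toMatrix_mapWires_mulVec_prodState A hE,
      ih (List.nodup_cons.1 hl).2]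
    congr 1
    funext i
    by_cases hij : i = j
    · subst hij
      simp [hj]
    · simp [hij]

/-! ### Summing over registers block by block -/

/-- The off-block wires as a subtype. [folklore] -/
abbrev OffWire (E : Fin m → (Fin b ↪ Fin W)) : Type := {w : Fin W // OffBlocks E w}

/-- For a wire in some block: the block and the position (unique for disjoint blocks). [folklore] -/
theorem existsUnique_of_not_offBlocks {E : Fin m → (Fin b ↪ Fin W)} (hE : BlockDisjoint E) {w : Fin W}
    (hw : ¬ OffBlocks E w) : ∃! ip : Fin m × Fin b, E ip.1 ip.2 = w := by
  simp only [OffBlocks, not_forall, not_not] at hw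
  obtain ⟨i, p, rfl⟩ := hw
  refine ⟨(i, p), rfl, ?_⟩
  rintro ⟨i', p'⟩ h
  have hii : i' = i := by
    by_contra hne
    exact Set.disjoint_left.1 (hE i' i hne) ⟨p', rfl⟩ ⟨p, h.symm⟩
  subst hii
  simp only [Prod.mk.injEq, true_and]
  exact (E i').injective h

/-- Gluing an off-block content and block contents into a register. [folklore] -/
def blockGlue {E : Fin m → (Fin b ↪ Fin W)} (hE : BlockDisjoint E) (r : OffWire E → Bool) (y : Fin m → QReg b) :
    QReg W :=
  fun w => if hw : OffBlocks E w then r ⟨w, hw⟩ else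
    y (Classical.choose (existsUnique_of_not_offBlocks hE hw)).1 (Classical.choose (existsUnique_of_not_offBlocks hE hw)).2

/-- Gluing, read on an off-block wire. [folklore] -/
theorem blockGlue_apply_of_offBlocks {E : Fin m → (Fin b ↪ Fin W)} (hE : BlockDisjoint E) (r : OffWire E → Bool)
    (y : Fin m → QReg b) {w : Fin W} (hw : OffBlocks E w) : blockGlue hE r y w = r ⟨w, hw⟩ := by
  unfold blockGlue
  rw [dif_pos hw]

/-- Gluing, read on a block wire. [folklore] -/
theorem blockGlue_apply_block {E : Fin m → (Fin b ↪ Fin W)} (hE : BlockDisjoint E) (r : OffWire E → Bool)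
    (y : Fin m → QReg b) (i : Fin m) (p : Fin b) : blockGlue hE r y (E i p) = y i p := by
  have hw : ¬ OffBlocks E (E i p) := fun h => h i ⟨p, rfl⟩
  unfold blockGlue
  rw [dif_neg hw]
  have hspec := Classical.choose_spec (existsUnique_of_not_offBlocks hE hw)
  have huniq : Classical.choose (existsUnique_of_not_offBlocks hE hw) = (i, p) :=
    (existsUnique_of_not_offBlocks hE hw).unique hspec.1 (show E (i, p).1 (i, p).2 = E i p from rfl)
  rw [huniq]

/-- **`QReg W ≃ (off-block wires → Bool) × (block contents)`** for pairwise disjoint blocks.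
[folklore] -/
def blockEquiv {E : Fin m → (Fin b ↪ Fin W)} (hE : BlockDisjoint E) :
    QReg W ≃ (OffWire E → Bool) × (Fin m → QReg b) where
  toFun z := (fun w => z w.1, fun i => z ∘ E i)
  invFun ry := blockGlue hE ry.1 ry.2
  left_inv z := by
    funext w
    by_cases hw : OffBlocks E w
    · exact blockGlue_apply_of_offBlocks hE _ _ hw
    · obtain ⟨⟨i, p⟩, rfl, -⟩ := existsUnique_of_not_offBlocks hE hw
      exact blockGlue_apply_block hE _ _ i p
  right_inv ry := by
    obtain ⟨r, y⟩ := ry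
    simp only [Prod.mk.injEq]
    exact ⟨funext fun w => blockGlue_apply_of_offBlocks hE r y w.2, funext fun i => funext fun p => blockGlue_apply_block hE r y i p⟩

/-- **Summing over the registers with prescribed off-block content.** For pairwise disjoint
blocks, `∑_z [z = c off the blocks] F(z|_{E₀}, …, z|_{E_{m-1}}) = ∑_{y} F(y)` over all tuples
`y` of block contents. [Nielsen–Chuang 2010, §2.2.8] [folklore] -/
theorem sum_prodIndicator {R : Type*} [NonAssocSemiring R] {E : Fin m → (Fin b ↪ Fin W)} (hE : BlockDisjoint E)
    (c : QReg W) (F : (Fin m → QReg b) → R) :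
    (∑ z : QReg W, (if ∀ w, OffBlocks E w → z w = c w then (1 : R) else 0) * F (fun i => z ∘ E i)) =
      ∑ y : Fin m → QReg b, F y := by
  rw [Fintype.sum_equiv (blockEquiv hE) _
    (fun ry : (OffWire E → Bool) × (Fin m → QReg b) =>
      (if ry.1 = fun w => c w.1 then (1 : R) else 0) * F ry.2) (fun z => ?_)]
  · rw [Fintype.sum_prod_type]
    simp [Finset.sum_ite_eq']
  · have hPQ : (∀ w, OffBlocks E w → z w = c w) ↔ ((fun w : OffWire E => z w.1) = fun w => c w.1) :=
      ⟨fun h => funext fun w => h w.1 w.2, fun h w hw => congrFun h ⟨w, hw⟩⟩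
    change (if ∀ w, OffBlocks E w → z w = c w then (1 : R) else 0) * F (fun i => z ∘ E i) =
      (if (fun w : OffWire E => z w.1) = (fun w => c w.1) then (1 : R) else 0) * F (fun i => z ∘ E i)
    by_cases hP : ∀ w, OffBlocks E w → z w = c w
    · rw [if_pos hP, if_pos (hPQ.1 hP)]
    · rw [if_neg hP, if_neg (mt hPQ.2 hP)]

/-- The Born weight of a product state: the off-block indicator times the product of the block
weights. [Nielsen–Chuang 2010, §2.2.8] [cite: NielsenChuang2010, §2.2.8] -/
theorem normSq_prodState_apply (E : Fin m → (Fin b ↪ Fin W)) (φ : Fin m → QReg b → ℂ) (c z : QReg W) :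
    ‖prodState E φ c z‖ ^ 2 =
      (if ∀ w, OffBlocks E w → z w = c w then (1 : ℝ) else 0) * ∏ i, ‖φ i (z ∘ E i)‖ ^ 2 := by
  rw [prodState_apply, norm_mul, mul_pow, norm_prod, ← Finset.prod_pow]
  by_cases h : ∀ w, OffBlocks E w → z w = c w
  · rw [if_pos h, if_pos h]; simp
  · rw [if_neg h, if_neg h]; simp

/-- **Born weights of a product state form the product distribution**: for any function `g` of
the block contents, `∑_z |prodState(z)|² g(blocks of z) = ∑_y (∏ᵢ |φᵢ(yᵢ)|²) g(y)`.
[Nielsen–Chuang 2010, §2.2.8] [cite: NielsenChuang2010, §2.2.8] -/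
theorem sum_normSq_prodState_mul {E : Fin m → (Fin b ↪ Fin W)} (hE : BlockDisjoint E)
    (φ : Fin m → QReg b → ℂ) (c : QReg W) (g : (Fin m → QReg b) → ℝ) :
    (∑ z : QReg W, ‖prodState E φ c z‖ ^ 2 * g (fun i => z ∘ E i)) =
      ∑ y : Fin m → QReg b, (∏ i, ‖φ i (y i)‖ ^ 2) * g y := by
  simp_rw [normSq_prodState_apply, mul_assoc]
  exact sum_prodIndicator hE c (fun y => (∏ i, ‖φ i (y i)‖ ^ 2) * g y)

/-! ### Circuits permuting the basis states -/

/-- **A circuit permuting basis states permutes amplitudes**: if `M|z⟩ = |π z⟩` for all `z` with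
`π` an injective self-map of the labels (a bijection, `Function.Embedding.equivOfFiniteSelfEmbedding`),
then `(Mψ)(π z) = ψ(z)`, i.e. `Mψ = ψ ∘ π⁻¹`. [Nielsen–Chuang 2010, §3.2.5 (reversible classical
computation on basis states)] [folklore] -/
theorem mulVec_eq_of_perm {M : Matrix (QReg W) (QReg W) ℂ} (π : QReg W ↪ QReg W)
    (hM : ∀ z, M *ᵥ basisState z = basisState (π z)) (ψ : QReg W → ℂ) :
    M *ᵥ ψ = fun y => ψ (π.equivOfFiniteSelfEmbedding.symm y) := by
  conv_lhs => rw [show ψ = ∑ z, ψ z • basisState z from by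
    funext x; simp [Finset.sum_apply, basisState_apply]]
  rw [Matrix.mulVec_sum]
  funext y
  simp only [Finset.sum_apply, Matrix.mulVec_smul, hM, Pi.smul_apply, basisState_apply, smul_eq_mul,
    mul_ite, mul_one, mul_zero]
  rw [Finset.sum_eq_single (π.equivOfFiniteSelfEmbedding.symm y)]
  · rw [if_pos]
    exact (π.equivOfFiniteSelfEmbedding.apply_symm_apply y).symm
  · intro z _ hz
    rw [if_neg]
    intro h
    apply hz
    rw [h]
    exact (π.equivOfFiniteSelfEmbedding.symm_apply_apply z).symm
  · intro h; exact absurd (Finset.mem_univ _) h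

/-- **Born weights after a basis permutation**: `∑_y [T y] |(Mψ)(y)|² = ∑_z [T (π z)] |ψ(z)|²`
— classical reversible post-processing before a measurement moves the measured event back along
`π`. [Nielsen–Chuang 2010, §3.2.5, §4.4] [folklore] -/
theorem sum_ite_normSq_mulVec_of_perm {M : Matrix (QReg W) (QReg W) ℂ} (π : QReg W ↪ QReg W)
    (hM : ∀ z, M *ᵥ basisState z = basisState (π z)) (ψ : QReg W → ℂ)
    (T : QReg W → Prop) [DecidablePred T] :
    (∑ y, if T y then ‖(M *ᵥ ψ) y‖ ^ 2 else 0) = ∑ z, if T (π z) then ‖ψ z‖ ^ 2 else 0 := by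
  rw [mulVec_eq_of_perm π hM ψ]
  rw [← Fintype.sum_equiv π.equivOfFiniteSelfEmbedding (fun z => if T (π z) then ‖ψ z‖ ^ 2 else 0)
    (fun y => if T y then ‖ψ (π.equivOfFiniteSelfEmbedding.symm y)‖ ^ 2 else 0) (fun z => by
      simp [Function.Embedding.equivOfFiniteSelfEmbedding, Equiv.ofBijective_apply])]

end Literature.Computability.QuantumComplexity
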